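import Literature.Analysis.FunctionSpaces.TorusTrigPoly
import Literature.Analysis.FunctionSpaces.TorusSpaceTimeFields
import HarnessLib

/-!
# Translations along a coordinate axis of the flat torus `T^d` and the axis average

Trunk: FluidKinetic / function spaces on `T^d = UnitAddTorus d`. Bookkeeping for fields on the
flat torus that are **invariant under all translations along one coordinate axis**,
`x ↦ x + s eᵢ` (`s : UnitAddCircle`, `eᵢ = Pi.single i`), i.e. fields that do not depend on
the `i`-th coordinate — the symmetry class of the "two-and-a-half-dimensional" flows
(`x₃`-independent three-dimensional vector fields; Majda–Bertozzi 2002, §2.3.1, Prop. 2.7;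
Bruè–De Lellis 2023, §3.1), consumed by the invariant form of Hopf's existence theorem
(`Literature/Analysis/FluidPDE/NSHopfInvariant`).

## Contents (all proved)

* `Torus.measurePreserving_add_single` — the axis translations preserve the volume of `T^d`.
* `Torus.fourier_apply_add`, `Torus.mFourier_add_single` — the characters are eigenfunctions of
  the axis translations: `e_k(x + s eᵢ) = e_{kᵢ}(s) e_k(x)` (Grafakos 2014, §3.1.1).
* `Torus.mFourierCoeff_comp_add_single` — Fourier coefficients of an axis translate:
  `𝓕(f(· + s eᵢ))(k) = e_{kᵢ}(s) 𝓕f(k)` (Grafakos 2014, Prop. 3.1.2 (5), translation property).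
* `Torus.mFourierCoeff_eq_zero_of_forall_add_single` — **a field invariant under all translations
  along the `i`-th axis has no Fourier modes with `kᵢ ≠ 0`** (translate by half a period of
  `e_{kᵢ}`, `fourier_add_half_inv_index`).
* `Torus.trigPoly_add_single`, `Torus.realTrigPoly_add_single` — conversely, a (real) vector
  trigonometric polynomial whose coefficients vanish at all frequencies with `kᵢ ≠ 0` is
  invariant under the axis translations.
* `Torus.axisAvg i v x = ∫ v (x + s eᵢ) ds` — the **average along the `i`-th axis** (Haar
  probability measure of `UnitAddCircle`): it is invariant under the axis translations
  (`axisAvg_add_single`, translation invariance of Haar measure), fixes invariant fields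
  (`axisAvg_eq_self_of_forall_add_single`), is a.e. strongly measurable
  (`aestronglyMeasurable_axisAvg`), jointly in time for time-dependent fields
  (`aestronglyMeasurable_uncurry_axisAvg`, `aestronglyMeasurable_stLift_axisAvg`), and
  **agrees a.e. with `v` as soon as every axis translate of `v ∈ L¹` agrees a.e. with `v`**
  (`axisAvg_ae_eq_of_forall_translate_ae_eq`; Fubini on `T^d × UnitAddCircle` through the
  measure-preserving shear `(x, s) ↦ x + s eᵢ`, `measurePreserving_add_single_prod`). This is the
  device producing an *everywhere* `xᵢ`-independent representative of an `L²` class that is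
  `xᵢ`-independent only almost everywhere.

## Mathlib search

Mathlib (this pin) has the characters `fourier`, `UnitAddTorus.mFourier` with `fourier_add`,
`mFourier_add` (additivity in the *frequency*), `fourier_add_half_inv_index`, Haar-measure
invariance (`integral_add_left_eq_self`, `map_add_right_eq_self`, `measurePreserving_add_right`)
and `MeasurePreserving.skew_product`; no statement about additivity of the characters in the
*space* variable on `UnitAddTorus`, no axis averages (searched `mFourier.*add`, `axisAvg`,
`average.*AddCircle`: none relevant).

## References

* L. Grafakos, *Classical Fourier Analysis*, 3rd ed., GTM 249 (2014), §3.1.1 and Prop. 3.1.2 (5)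
  (Fourier coefficients of translates, `(τ^y f)^(m) = f̂(m) e^{-2πi m·y}`; 2nd ed. 2008, p. 176).
* A. J. Majda, A. L. Bertozzi, *Vorticity and Incompressible Flow* (CUP 2002), §2.3.1, Prop. 2.7
  (two-and-a-half-dimensional flows: `x₃`-independent 3-D fields).
* E. Bruè, C. De Lellis, *Anomalous dissipation for the forced 3D Navier–Stokes equations*,
  Comm. Math. Phys. 400 (2023), §3.1.
-/

open MeasureTheory Set Filter Topology UnitAddTorus Function
open scoped ENNReal NNReal InnerProductSpace

noncomputable section

namespace Literature.Analysis.FunctionSpaces.Torus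

variable {d : Type*} [Fintype d] [DecidableEq d]

/-! ## Axis translations: volume and characters -/

section Translate

variable {F : Type*} [NormedAddCommGroup F] [NormedSpace ℂ F]

/-- The axis translation `x ↦ x + s eᵢ` preserves the volume of `T^d` (Haar measure is
translation invariant). [folklore] -/
theorem measurePreserving_add_single (i : d) (s : UnitAddCircle) :
    MeasurePreserving (fun x : UnitAddTorus d => x + Pi.single i s) volume volume :=
  measurePreserving_add_right volume _

omit [Fintype d] [DecidableEq d] in
/-- The characters of the circle are additive characters: `e_n(a + b) = e_n(a) e_n(b)`
(Grafakos 2014, §3.1.1). [cite: Grafakos2014, §3.1.1] -/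
theorem fourier_apply_add (n : ℤ) (a b : UnitAddCircle) :
    fourier n (a + b) = fourier n a * fourier n b := by
  simp only [fourier_apply, zsmul_add, AddCircle.toCircle_add, Circle.coe_mul]

omit [Fintype d] [DecidableEq d] in
/-- `e_n(a) e_{-n}(a) = 1`. [folklore] -/
theorem fourier_mul_fourier_neg (n : ℤ) (a : UnitAddCircle) :
    fourier n a * fourier (-n) a = 1 := by
  rw [← fourier_add, add_neg_cancel, fourier_zero]

omit [Fintype d] [DecidableEq d] in
/-- Translation by half a period negates a nonconstant character: `e_n(1/(2n)) = -1` for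
`n ≠ 0` (Mathlib's `fourier_add_half_inv_index` at the origin). [folklore] -/
theorem fourier_half_inv {n : ℤ} (hn : n ≠ 0) :
    fourier n (((1 : ℝ) / 2 / n : ℝ) : UnitAddCircle) = -1 := by
  have h := fourier_add_half_inv_index hn one_pos (0 : UnitAddCircle)
  rwa [zero_add, fourier_eval_zero] at h

/-- **The characters of `T^d` are eigenfunctions of the axis translations**:
`e_k(x + s eᵢ) = e_{kᵢ}(s) e_k(x)` (Grafakos 2014, §3.1.1). [cite: Grafakos2014, §3.1.1] -/
theorem mFourier_add_single (k : d → ℤ) (i : d) (s : UnitAddCircle) (x : UnitAddTorus d) :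
    mFourier k (x + Pi.single i s) = fourier (k i) s * mFourier k x := by
  simp only [mFourier, ContinuousMap.coe_mk, Pi.add_apply]
  have h : ∀ j, fourier (k j) (x j + (Pi.single i s : UnitAddTorus d) j) =
      fourier (k j) (x j) * (if j = i then fourier (k i) s else 1) := by
    intro j
    by_cases hj : j = i
    · subst hj
      rw [Pi.single_eq_same, if_pos rfl, fourier_apply_add]
    · rw [Pi.single_eq_of_ne hj, add_zero, if_neg hj, mul_one]
  simp_rw [h, Finset.prod_mul_distrib, Finset.prod_ite_eq' Finset.univ i,
    if_pos (Finset.mem_univ i)]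
  ring

/-- **Fourier coefficients of an axis translate**: `𝓕(f(· + s eᵢ))(k) = e_{kᵢ}(s) • 𝓕f(k)`
(Grafakos 2014, Prop. 3.1.2 (5); change of variables `x ↦ x + s eᵢ` in the defining integral,
no integrability needed). [cite: Grafakos2014, Prop. 3.1.2 (5)] -/
theorem mFourierCoeff_comp_add_single (f : UnitAddTorus d → F) (k : d → ℤ) (i : d)
    (s : UnitAddCircle) :
    mFourierCoeff (fun x => f (x + Pi.single i s)) k = (fourier (k i) s : ℂ) • mFourierCoeff f k := by
  rw [mFourierCoeff_eq_integral_volume, mFourierCoeff_eq_integral_volume, ← integral_smul]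
  set G : UnitAddTorus d → F := fun y => (fourier (k i) s : ℂ) • (mFourier (-k) y • f y) with hG
  have h : ∀ x, mFourier (-k) x • f (x + Pi.single i s) = G (x + Pi.single i s) := by
    intro x
    rw [hG]
    simp only
    rw [mFourier_add_single, Pi.neg_apply, smul_smul, ← mul_assoc, fourier_mul_fourier_neg,
      one_mul]
  simp_rw [h]
  exact integral_add_right_eq_self G _

/-- **Fields invariant under all translations along the `i`-th axis have no Fourier modes with
`kᵢ ≠ 0`.** If `f (x + s eᵢ) = f x` for all `s : UnitAddCircle` and all `x`, then `𝓕f(k) = 0`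
whenever `kᵢ ≠ 0`: by `mFourierCoeff_comp_add_single` with `s = 1/(2kᵢ)`,
`𝓕f(k) = e_{kᵢ}(1/(2kᵢ)) 𝓕f(k) = -𝓕f(k)` (the Fourier side of "`f` does not depend on `xᵢ`";
Majda–Bertozzi 2002, §2.3.1). [folklore] -/
theorem mFourierCoeff_eq_zero_of_forall_add_single {f : UnitAddTorus d → F} {i : d}
    (hf : ∀ (s : UnitAddCircle) (x : UnitAddTorus d), f (x + Pi.single i s) = f x) {k : d → ℤ}
    (hk : k i ≠ 0) : mFourierCoeff f k = 0 := by
  have h := mFourierCoeff_comp_add_single f k i (((1 : ℝ) / 2 / (k i) : ℝ) : UnitAddCircle)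
  have hf' : (fun x => f (x + Pi.single i ((((1 : ℝ) / 2 / (k i) : ℝ) : UnitAddCircle)))) = f :=
    funext (hf _)
  rw [hf', fourier_half_inv hk, neg_one_smul] at h
  have h2 : (2 : ℂ) • mFourierCoeff f k = 0 := by
    rw [two_smul]
    nth_rewrite 2 [h]
    exact add_neg_cancel _
  exact (smul_eq_zero.1 h2).resolve_left two_ne_zero

variable {V : Type*} [NormedAddCommGroup V] [NormedSpace ℂ V]

/-- **A vector trigonometric polynomial without modes `kᵢ ≠ 0` is invariant under the axis
translations** `x ↦ x + s eᵢ` (each retained character satisfies `e_k(x + s eᵢ) = e_k(x)` as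
`e_0 = 1`). [folklore] -/
theorem trigPoly_add_single {S : Finset (d → ℤ)} {c : (d → ℤ) → V} {i : d}
    (hc : ∀ k ∈ S, k i ≠ 0 → c k = 0) (s : UnitAddCircle) (x : UnitAddTorus d) :
    trigPoly S c (x + Pi.single i s) = trigPoly S c x := by
  rw [trigPoly_apply, trigPoly_apply]
  refine Finset.sum_congr rfl fun k hk => ?_
  by_cases hki : k i = 0
  · rw [mFourier_add_single, hki, fourier_zero, one_mul]
  · rw [hc k hk hki, smul_zero, smul_zero]

/-- The real form: a real vector trigonometric polynomial without modes `kᵢ ≠ 0` is invariant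
under the axis translations `x ↦ x + s eᵢ`. [folklore] -/
theorem realTrigPoly_add_single {S : Finset (d → ℤ)} {c : (d → ℤ) → EuclideanSpace ℂ d} {i : d}
    (hc : ∀ k ∈ S, k i ≠ 0 → c k = 0) (s : UnitAddCircle) (x : UnitAddTorus d) :
    realTrigPoly S c (x + Pi.single i s) = realTrigPoly S c x := by
  rw [realTrigPoly_apply, realTrigPoly_apply, trigPoly_add_single hc]

end Translate

/-! ## The axis average -/

section AxisAverage

variable {F : Type*} [NormedAddCommGroup F] [NormedSpace ℝ F]

omit [Fintype d] in
/-- **The average of a field along the `i`-th coordinate axis** of the flat torus: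
`axisAvg i v x = ∫ v (x + s eᵢ) ds`, the integral over `s : UnitAddCircle` for its Haar
probability measure (Bochner integral; `0` at points where `s ↦ v (x + s eᵢ)` is not
integrable). For a field that does not depend on `xᵢ` this is the field itself; in general it is
the orthogonal projection onto the `xᵢ`-independent fields (the Fourier modes with `kᵢ = 0`),
the "two-and-a-half-dimensional" part of a three-dimensional field (Majda–Bertozzi 2002,
§2.3.1, Prop. 2.7). [folklore] -/
def axisAvg (i : d) (v : UnitAddTorus d → F) (x : UnitAddTorus d) : F :=
  ∫ s : UnitAddCircle, v (x + Pi.single i s)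

omit [Fintype d] in
/-- Unfolding `axisAvg`. [folklore] -/
theorem axisAvg_apply (i : d) (v : UnitAddTorus d → F) (x : UnitAddTorus d) :
    axisAvg i v x = ∫ s : UnitAddCircle, v (x + Pi.single i s) := rfl

omit [Fintype d] in
/-- **The axis average is invariant under the axis translations**, at every point:
`axisAvg i v (x + s eᵢ) = axisAvg i v x` (translation invariance of the Haar integral on
`UnitAddCircle`, `∫ g (s + t) dt = ∫ g t dt`; no integrability needed). [folklore] -/
theorem axisAvg_add_single (i : d) (v : UnitAddTorus d → F) (s : UnitAddCircle)
    (x : UnitAddTorus d) : axisAvg i v (x + Pi.single i s) = axisAvg i v x := by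
  unfold axisAvg
  have h : ∀ t : UnitAddCircle, x + Pi.single i s + (Pi.single i t : UnitAddTorus d) =
      x + (Pi.single i (s + t) : UnitAddTorus d) := by
    intro t
    rw [Pi.single_add, add_assoc]
  simp_rw [h]
  exact integral_add_left_eq_self (μ := (volume : Measure UnitAddCircle))
    (fun t => v (x + (Pi.single i t : UnitAddTorus d))) s

omit [Fintype d] in
/-- The axis average fixes the fields invariant under the axis translations (the measure of
`UnitAddCircle` is a probability measure). [folklore] -/
theorem axisAvg_eq_self_of_forall_add_single [CompleteSpace F] {i : d} {v : UnitAddTorus d → F}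
    (hv : ∀ (s : UnitAddCircle) (x : UnitAddTorus d), v (x + Pi.single i s) = v x) :
    axisAvg i v = v := by
  funext x
  unfold axisAvg
  simp_rw [hv]
  rw [integral_const]
  simp

/-- **The shear `(x, s) ↦ x + s eᵢ` is measure preserving** from `T^d × UnitAddCircle`
(product of the volumes) onto `T^d`: the skew product `(s, x) ↦ (s, x + s eᵢ)` preserves the
product measure (`MeasurePreserving.skew_product`, each `x ↦ x + s eᵢ` preserving the volume),
and the second projection pushes the product forward to the volume of `T^d` because
`UnitAddCircle` has total mass one. [folklore] -/
theorem measurePreserving_add_single_prod (i : d) :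
    MeasurePreserving (fun p : UnitAddTorus d × UnitAddCircle => p.1 + Pi.single i p.2)
      ((volume : Measure (UnitAddTorus d)).prod (volume : Measure UnitAddCircle)) volume := by
  have h1 : MeasurePreserving
      (fun p : UnitAddCircle × UnitAddTorus d => (p.1, p.2 + Pi.single i p.1))
      ((volume : Measure UnitAddCircle).prod (volume : Measure (UnitAddTorus d)))
      ((volume : Measure UnitAddCircle).prod (volume : Measure (UnitAddTorus d))) := by
    refine (MeasurePreserving.id (volume : Measure UnitAddCircle)).skew_product
      (μc := (volume : Measure (UnitAddTorus d)))
      (g := fun (s : UnitAddCircle) (x : UnitAddTorus d) => x + Pi.single i s) ?_ ?_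
    · exact (continuous_snd.add ((continuous_single i).comp continuous_fst)).measurable
    · exact ae_of_all _ fun s => map_add_right_eq_self volume (Pi.single i s : UnitAddTorus d)
  have h2 : MeasurePreserving (Prod.snd : UnitAddCircle × UnitAddTorus d → UnitAddTorus d)
      ((volume : Measure UnitAddCircle).prod volume) volume := by
    refine ⟨measurable_snd, ?_⟩
    rw [Measure.map_snd_prod, measure_univ, one_smul]
  exact (h2.comp h1).comp
    (Measure.measurePreserving_swap (μ := (volume : Measure (UnitAddTorus d)))
      (ν := (volume : Measure UnitAddCircle)))

/-- The axis average of an a.e. strongly measurable field is a.e. strongly measurable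
(a parametric integral of the field composed with the measure-preserving shear). [folklore] -/
theorem aestronglyMeasurable_axisAvg {i : d} {v : UnitAddTorus d → F}
    (hv : AEStronglyMeasurable v volume) : AEStronglyMeasurable (axisAvg i v) volume :=
  (hv.comp_measurePreserving (measurePreserving_add_single_prod i)).integral_prod_right'

/-- **The axis average of an `L¹` field all of whose axis translates agree a.e. with it is
a.e. equal to the field.** If `v ∈ L¹(T^d)` and `v (· + s eᵢ) = v` a.e. for *every*
`s : UnitAddCircle`, then `axisAvg i v = v` a.e. Proof: for a.e. `x` the section
`s ↦ v (x + s eᵢ)` is integrable (Fubini through `measurePreserving_add_single_prod`), so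
`‖axisAvg i v x - v x‖ ≤ ∫ ‖v (x + s eᵢ) - v x‖ ds`; integrating in `x` and swapping the
integrals (Tonelli), the inner `x`-integral vanishes for every `s`. This turns an a.e. symmetric
`L¹` class into an everywhere symmetric representative (`axisAvg_add_single`). [folklore] -/
theorem axisAvg_ae_eq_of_forall_translate_ae_eq [CompleteSpace F] {i : d} {v : UnitAddTorus d → F}
    (hv : Integrable v volume)
    (h : ∀ s : UnitAddCircle, (fun x => v (x + Pi.single i s)) =ᵐ[volume] v) :
    axisAvg i v =ᵐ[volume] v := by
  have hπ := measurePreserving_add_single_prod i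
  have hG : Integrable (fun p : UnitAddTorus d × UnitAddCircle => v (p.1 + Pi.single i p.2))
      ((volume : Measure (UnitAddTorus d)).prod (volume : Measure UnitAddCircle)) :=
    (hπ.integrable_comp hv.aestronglyMeasurable).2 hv
  -- sections are integrable for a.e. `x`
  have hsec : ∀ᵐ x ∂(volume : Measure (UnitAddTorus d)),
      Integrable (fun s : UnitAddCircle => v (x + Pi.single i s)) volume := hG.prod_right_ae
  -- the difference integrand on the product
  set D : UnitAddTorus d → UnitAddCircle → ℝ≥0∞ := fun x s => ‖v (x + Pi.single i s) - v x‖ₑ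
    with hDdef
  have hD : AEMeasurable (uncurry D)
      ((volume : Measure (UnitAddTorus d)).prod (volume : Measure UnitAddCircle)) := by
    have h1 : AEStronglyMeasurable (fun p : UnitAddTorus d × UnitAddCircle => v p.1)
        ((volume : Measure (UnitAddTorus d)).prod (volume : Measure UnitAddCircle)) :=
      hv.aestronglyMeasurable.comp_quasiMeasurePreserving
        (Measure.quasiMeasurePreserving_fst (μ := (volume : Measure (UnitAddTorus d)))
          (ν := (volume : Measure UnitAddCircle)))
    exact (hG.aestronglyMeasurable.sub h1).enorm
  -- pointwise bound for a.e. `x`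
  have hpt : ∀ᵐ x ∂(volume : Measure (UnitAddTorus d)), ‖axisAvg i v x - v x‖ₑ ≤ ∫⁻ s, D x s := by
    filter_upwards [hsec] with x hx
    have heq : axisAvg i v x - v x = ∫ s : UnitAddCircle, (v (x + Pi.single i s) - v x) := by
      rw [integral_sub hx (integrable_const _), axisAvg_apply, integral_const]
      simp
    rw [heq]
    exact enorm_integral_le_lintegral_enorm _
  -- for every `s` the `x`-integral of the difference vanishes
  have hDs : ∀ s, ∫⁻ x, D x s = 0 := by
    intro s
    have hae : (fun x => D x s) =ᵐ[volume] fun _ => 0 := by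
      filter_upwards [h s] with x hx
      simp only [hDdef, hx, sub_self, enorm_zero]
    rw [lintegral_congr_ae hae, lintegral_zero]
  -- integrate and swap
  have hzero : ∫⁻ x, ‖axisAvg i v x - v x‖ₑ ∂(volume : Measure (UnitAddTorus d)) = 0 := by
    refine le_antisymm ?_ (zero_le)
    calc ∫⁻ x, ‖axisAvg i v x - v x‖ₑ ∂(volume : Measure (UnitAddTorus d))
        ≤ ∫⁻ x, ∫⁻ s, D x s := lintegral_mono_ae hpt
      _ = ∫⁻ s, ∫⁻ x, D x s := lintegral_lintegral_swap hD
      _ = 0 := by simp_rw [hDs, lintegral_zero]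
  have hmeas : AEMeasurable (fun x => ‖axisAvg i v x - v x‖ₑ) (volume : Measure (UnitAddTorus d)) :=
    ((aestronglyMeasurable_axisAvg hv.aestronglyMeasurable).sub hv.aestronglyMeasurable).enorm
  have hae := (lintegral_eq_zero_iff' hmeas).1 hzero
  filter_upwards [hae] with x hx
  have hx' : ‖axisAvg i v x - v x‖ₑ = 0 := hx
  rwa [enorm_eq_zero, sub_eq_zero] at hx'

/-- **Joint measurability of the axis average of a time-dependent field.** If
`uncurry u : ℝ × T^d → F` is a.e. strongly measurable for `(vol|_S) ⊗ vol`, then so is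
`uncurry (t ↦ axisAvg i (u t))`: it is the parametric integral, over `s : UnitAddCircle`, of
`uncurry u` composed with the measure-preserving map `((t, x), s) ↦ (t, x + s eᵢ)`. [folklore] -/
theorem aestronglyMeasurable_uncurry_axisAvg {S : Set ℝ} {u : ℝ → UnitAddTorus d → F}
    (hu : AEStronglyMeasurable (uncurry u) ((volume.restrict S).prod volume)) (i : d) :
    AEStronglyMeasurable (uncurry fun t => axisAvg i (u t)) ((volume.restrict S).prod volume) := by
  have hP : MeasurePreserving
      (fun q : (ℝ × UnitAddTorus d) × UnitAddCircle => (q.1.1, q.1.2 + Pi.single i q.2))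
      (((volume.restrict S).prod (volume : Measure (UnitAddTorus d))).prod
        (volume : Measure UnitAddCircle))
      ((volume.restrict S).prod volume) := by
    have h1 := (MeasurePreserving.id (volume.restrict S)).prod (measurePreserving_add_single_prod i)
    have h2 := measurePreserving_prodAssoc (volume.restrict S) (volume : Measure (UnitAddTorus d))
      (volume : Measure UnitAddCircle)
    exact h1.comp h2
  exact (hu.comp_measurePreserving hP).integral_prod_right'

omit [DecidableEq d] in
/-- From measurability of the space–time lift on `S × ℝ^d` to measurability of the uncurried
field for the product measure `(vol|_S) ⊗ vol` on `ℝ × T^d` (rewriting of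
`Torus.aestronglyMeasurable_uncurry_of_stLift_restrict`). [folklore] -/
theorem aestronglyMeasurable_uncurry_of_stLift_prod {G : Type*} [TopologicalSpace G] {S : Set ℝ}
    {u : ℝ → UnitAddTorus d → G} (hu : AEStronglyMeasurable (stLift u) (volume.restrict (S ×ˢ univ))) :
    AEStronglyMeasurable (uncurry u) ((volume.restrict S).prod volume) := by
  have h := aestronglyMeasurable_uncurry_of_stLift_restrict hu
  rwa [Measure.volume_eq_prod, ← Measure.prod_restrict, Measure.restrict_univ] at h

/-- **The space–time lift of the axis-averaged field is a.e. strongly measurable** on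
`S × ℝ^d` whenever that of the field is (`aestronglyMeasurable_uncurry_axisAvg` transported
through the covering map, `Torus.aestronglyMeasurable_stLift_of_uncurry`). [folklore] -/
theorem aestronglyMeasurable_stLift_axisAvg {S : Set ℝ} {u : ℝ → UnitAddTorus d → F}
    (hu : AEStronglyMeasurable (stLift u) (volume.restrict (S ×ˢ univ))) (i : d) :
    AEStronglyMeasurable (stLift fun t => axisAvg i (u t))
      (volume.restrict (S ×ˢ (univ : Set (EuclideanSpace ℝ d)))) :=
  aestronglyMeasurable_stLift_of_uncurry
    (aestronglyMeasurable_uncurry_axisAvg (aestronglyMeasurable_uncurry_of_stLift_prod hu) i)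

end AxisAverage

end Literature.Analysis.FunctionSpaces.Torus
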